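import Mathlib
import HarnessLib
import Summits.NavierStokesRegularity.NavierStokesRegularity.Theorems.UnthreadedDoorNetFluxEnvelopeDefect
import Summits.NavierStokesRegularity.NavierStokesRegularity.Theorems.UnthreadedDoorNetFluxEnvelopeOneSided

/-!
# Route `UnthreadedDoor`, crux `PoloidalLiouville` (stmt-NavierStokesRegularity-1222), WALL W1 `stub_scalarLiouville` —
# crux idea «netflux-typei-gap» (ns-idea-14, LINE v5 = VISCOSITY interface): stub NF-1bᵛ `EnvelopeFacts`, part (c) and ASSEMBLY

KEY-NS #156/#157 (director-ns g16; author ns-idea-14, «NETFLUX LINE v5» bcd4955f0879).  `NetFlux.EnvelopeFacts` (Lines file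
`Cruxes/PoloidalLiouville/Lines/netflux_typei_gap.lean`, §1) asks, for `T` smooth on `]t₀,0[ × (ℝ³ ∖ {x₀})`, for:
(a) joint continuity of the spherical sup/inf envelopes (`continuousOn_sphSup_family`, p662790; `continuousOn_sphInf_family`,
p664847); (b) one-sided `r`-derivatives of `r ↦ r·max_{S_r} T(t)` / `r ↦ r·min_{S_r} T(t)` with the semiconvex / semiconcave
ordering (`exists_oneSided_deriv_rsphSup` / `exists_oneSided_deriv_rsphInf`, p664847); and (c) the UNIFORM SECOND-DIFFERENCE
TOUCHING BOUND proved here: for `t ∈ ]t₀,0[` and `0 < a ≤ R` there are `M` and `k₀ ∈ ]0,a[` such that for `k ∈ ]0,k₀[`, `r ∈ [a,R]`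
and every maximiser `x ∈ argmax_{S_r(x₀)} T(t)`,
`r ∂_r²T(t,x) + 2 ∂_rT(t,x) ≤ Δ²_k[ρ ↦ ρ·max_{S_ρ} T(t)](r) / k² + M k`
(and the mirror inequality at minimisers for the inf envelope).  PROOF (viscosity touching): with `x = x₀ + r ξ`, the slice
`g(ρ) = ρ·T(t, x₀ + ρ ξ)` lies below the envelope `F(ρ) = ρ·max_{S_ρ} T(t)` and touches it at `ρ = r`, so `Δ²_k g(r) ≤ Δ²_k F(r)`;
Taylor–Lagrange to second order on `[r, r ± k]` gives `Δ²_k g(r) = (k²/2)(g''(θ₊) + g''(θ₋))`, and `|g''(θ) − g''(r)| ≤ M |θ − r|`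
with `M` a bound of the third `ρ`-derivative of the smooth kernel `(ρ, ξ) ↦ ρ·T(t, x₀ + ρ ξ)` on the compact `[a/2, R + a/2] × S²`;
finally `g''(r) = 2 ∂_ξT(x) + r ∂_ξ²T(x) = 2·radDeriv + r·radDeriv2` at `x`.  The inf case is the sup case of `−T`.

* `sphArgmin_eq_sphArgmax_neg`, `sphSup_neg_eq`, `radDeriv_neg`, `radDeriv2_neg` — the `T ↦ −T` symmetries;
* `exists_secondDiff_touching_sup` — (c) at maximisers;  `exists_secondDiff_touching_inf` — (c) at minimisers;
* `exists_secondDiff_touching` — (c) with common constants;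
* `envelopeFacts` — **the statement of `NetFlux.EnvelopeFacts` (Lines file §1, verbatim body), proved**: closes `stub_envelopeFacts`
  of the line BY NAME (`Iff.rfl`/definitional unfolding; the line's `theorem stub_envelopeFacts : EnvelopeFacts` is this theorem).

WHAT THIS IS NOT: no NS-regularity statement is touched; `EnvelopeFacts` is pure calculus of a smooth function (the VISCOSITY
interface the line's NF-3ᵛ/NF-4 consume); `PoloidalLiouville` (1222), W1, the line's rung target `TypeI_Liouville_noswirl` and the
summit stay OPEN.  `--supports stmt-NavierStokesRegularity-1222 --as helper`.  [folklore]
-/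

noncomputable section

-- the summit and its single sub-problem share the name (CONVENTIONS §1)
set_option linter.dupNamespace false

open Set Function Filter Topology InnerProductSpace MeasureTheory
open scoped RealInnerProductSpace ContDiff

namespace Summit.NavierStokesRegularity.NavierStokesRegularity.Theorems.PoloidalLiouville.NetFlux

open Literature.Analysis Literature.Analysis.FluidPDE

variable {T : ℝ → E3 → ℝ} {x₀ : E3} {t₀ : ℝ}

/-! ### `T ↦ −T` symmetries -/

/-- `argmin_{S_r(x₀)} f = argmax_{S_r(x₀)} (−f)`. [folklore] -/
theorem sphArgmin_eq_sphArgmax_neg (f : E3 → ℝ) (x₀ : E3) (r : ℝ) :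
    sphArgmin f x₀ r = sphArgmax (fun x => -f x) x₀ r := by
  ext x
  simp only [sphArgmin, sphArgmax, mem_setOf_eq, neg_le_neg_iff]

/-- `max_{S_r(x₀)} (−f) = − min_{S_r(x₀)} f`. [folklore] -/
theorem sphSup_neg_eq (f : E3 → ℝ) (x₀ : E3) (r : ℝ) : sphSup (fun x => -f x) x₀ r = -sphInf f x₀ r := by
  rw [sphInf_eq_neg_sphSup_neg, neg_neg]

/-- `∂_r(−f) = −∂_r f` (radial derivatives about `x₀`). [folklore] -/
theorem radDeriv_neg (f : E3 → ℝ) (x₀ x : E3) : radDeriv (fun y => -f y) x₀ x = -radDeriv f x₀ x := by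
  unfold radDeriv
  exact deriv.fun_neg

/-- `∂_r²(−f) = −∂_r² f` (second radial derivatives about `x₀`). [folklore] -/
theorem radDeriv2_neg (f : E3 → ℝ) (x₀ x : E3) : radDeriv2 (fun y => -f y) x₀ x = -radDeriv2 f x₀ x := by
  unfold radDeriv2
  exact iteratedDeriv_fun_neg 2 _ _

/-! ### (c) the uniform second-difference touching bound at maximisers -/

/-- **Second-difference touching bound (sup envelope)**: for `T` smooth on `]t₀,0[ × (ℝ³ ∖ {x₀})`, `t ∈ ]t₀,0[`, `0 < a` and `R`,
there are `M` and `k₀ ∈ ]0,a[` such that for all `k ∈ ]0,k₀[`, `r ∈ [a,R]` and every maximiser `x ∈ argmax_{S_r(x₀)} T(t)`,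
`r ∂_r²T(t,x) + 2 ∂_rT(t,x) ≤ Δ²_k[ρ ↦ ρ · max_{S_ρ(x₀)} T(t)](r)/k² + M k` (the line's extra hypothesis `a ≤ R` is not
needed) — the slice `ρ ↦ ρ T(t, x₀ + ρ ξ)` through the maximiser touches the envelope from below at `ρ = r` (Taylor–Lagrange to
second order, uniform third-derivative bound on `[a/2, R + a/2] × S²`). [folklore] -/
theorem exists_secondDiff_touching_sup (hT : ContDiffOn ℝ (⊤ : ℕ∞) (uncurry T) (Ioo t₀ 0 ×ˢ ({x₀}ᶜ : Set E3)))
    {t : ℝ} (ht : t ∈ Ioo t₀ 0) {a R : ℝ} (ha : 0 < a) :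
    ∃ M k₀ : ℝ, 0 < k₀ ∧ k₀ < a ∧ ∀ k ∈ Ioo 0 k₀, ∀ r ∈ Icc a R, ∀ x ∈ sphArgmax (T t) x₀ r,
      r * radDeriv2 (T t) x₀ x + 2 * radDeriv (T t) x₀ x
        ≤ ((r + k) * sphSup (T t) x₀ (r + k) - 2 * (r * sphSup (T t) x₀ r)
            + (r - k) * sphSup (T t) x₀ (r - k)) / k ^ 2 + M * k := by
  have hTt : ContDiffOn ℝ (⊤ : ℕ∞) (T t) ({x₀}ᶜ) := contDiffOn_slice_compl hT ht
  have hO : IsOpen ({x₀}ᶜ : Set E3) := isOpen_compl_singleton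
  have hTc : ContinuousOn (T t) ({x₀}ᶜ) := hTt.continuousOn
  have hTd : ∀ y : E3, y ≠ x₀ → DifferentiableAt ℝ (T t) y := fun y hy =>
    (hTt.differentiableOn (by simp) y hy).differentiableAt (hO.mem_nhds hy)
  have hT2 : ContDiffOn ℝ (⊤ : ℕ∞) (fderiv ℝ (T t)) ({x₀}ᶜ) := hTt.fderiv_of_isOpen hO (by simp)
  have hT2d : ∀ y : E3, y ≠ x₀ → DifferentiableAt ℝ (fderiv ℝ (T t)) y := fun y hy =>
    (hT2.differentiableOn (by simp) y hy).differentiableAt (hO.mem_nhds hy)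
  -- the kernel `Ĝ(ρ, ξ) = ρ · T(t, x₀ + ρ ξ)` is smooth on `W₀ = ]0,∞[ × (ℝ³ ∖ {0})`
  set W₀ : Set (ℝ × E3) := Ioi (0 : ℝ) ×ˢ ({0}ᶜ : Set E3) with hW₀
  have hW₀o : IsOpen W₀ := isOpen_Ioi.prod isOpen_compl_singleton
  set G : ℝ × E3 → ℝ := fun q => q.1 * T t (x₀ + q.1 • q.2) with hG
  have hmaps : MapsTo (fun q : ℝ × E3 => x₀ + q.1 • q.2) W₀ ({x₀}ᶜ) := by
    intro q hq h0
    simp only [mem_singleton_iff, add_eq_left, smul_eq_zero] at h0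
    rcases h0 with h0 | h0
    · exact (ne_of_gt (show (0 : ℝ) < q.1 from hq.1)) h0
    · exact hq.2 h0
  have hGs : ContDiffOn ℝ (⊤ : ℕ∞) G W₀ :=
    contDiffOn_fst.mul (hTt.comp (contDiffOn_const.add (contDiffOn_fst.smul contDiffOn_snd)) hmaps)
  -- iterated `ρ`-derivatives of the kernel, all smooth on `W₀`
  set G₁ : ℝ × E3 → ℝ := fun q => deriv (fun s => G (s, q.2)) q.1 with hG₁
  set G₂ : ℝ × E3 → ℝ := fun q => deriv (fun s => G₁ (s, q.2)) q.1 with hG₂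
  set G₃ : ℝ × E3 → ℝ := fun q => deriv (fun s => G₂ (s, q.2)) q.1 with hG₃
  have hG₁s : ContDiffOn ℝ (⊤ : ℕ∞) G₁ W₀ := (contDiffOn_deriv_tslice hW₀o hGs).2
  have hG₂s : ContDiffOn ℝ (⊤ : ℕ∞) G₂ W₀ := (contDiffOn_deriv_tslice hW₀o hG₁s).2
  have hG₃s : ContDiffOn ℝ (⊤ : ℕ∞) G₃ W₀ := (contDiffOn_deriv_tslice hW₀o hG₂s).2
  -- a uniform bound for `G₃` on the compact `[c,d] × S²`, `c = a/2`, `d = R + a/2`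
  set c : ℝ := a / 2 with hc
  set d : ℝ := R + a / 2 with hd
  have hc0 : 0 < c := by rw [hc]; positivity
  have hK : IsCompact (Icc c d ×ˢ Metric.sphere (0 : E3) 1) := isCompact_Icc.prod (isCompact_sphere 0 1)
  have hKW : Icc c d ×ˢ Metric.sphere (0 : E3) 1 ⊆ W₀ := by
    rintro ⟨ρ, η⟩ ⟨hρ, hη⟩
    refine ⟨hc0.trans_le hρ.1, fun h0 => ?_⟩
    have h1 : ‖η‖ = 1 := by simpa using hη
    have h0' : η = 0 := h0
    rw [h0', norm_zero] at h1
    exact zero_ne_one h1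
  obtain ⟨M₃, hM₃⟩ := hK.exists_bound_of_continuousOn (hG₃s.continuousOn.mono hKW)
  set M : ℝ := max M₃ 0 with hM
  have hM0 : 0 ≤ M := le_max_right _ _
  have hb₃ : ∀ ρ ∈ Icc c d, ∀ η ∈ Metric.sphere (0 : E3) 1, |G₃ (ρ, η)| ≤ M := by
    intro ρ hρ η hη
    have h := hM₃ (ρ, η) ⟨hρ, hη⟩
    rw [Real.norm_eq_abs] at h
    exact h.trans (le_max_left _ _)
  refine ⟨M, a / 2, by positivity, by linarith, ?_⟩
  intro k hk r hr x hx
  have hk0 : 0 < k := hk.1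
  have hr0 : 0 < r := ha.trans_le hr.1
  have hrk₁ : c ≤ r - k := by rw [hc]; linarith [hk.2, hr.1]
  have hrk₂ : r + k ≤ d := by rw [hd]; linarith [hk.2, hr.2]
  have hrkpos : 0 < r - k := hc0.trans_le hrk₁
  have hrI : r ∈ Icc c d := ⟨by linarith, by linarith⟩
  -- the maximiser `x = x₀ + r ξ`, `ξ ∈ S²`
  have hxS : x ∈ Metric.sphere x₀ r := sphArgmax_subset_sphere _ _ _ hx
  have hxne : x ≠ x₀ := ne_center_of_mem_sphere hr0 hxS
  have hxn : ‖x - x₀‖ = r := mem_sphere_iff_norm.1 hxS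
  set ξ : E3 := r⁻¹ • (x - x₀) with hξ
  have hξ1 : ‖ξ‖ = 1 := by
    rw [hξ, norm_smul, norm_inv, Real.norm_of_nonneg hr0.le, hxn, inv_mul_cancel₀ hr0.ne']
  have hξS : ξ ∈ Metric.sphere (0 : E3) 1 := mem_sphere_zero_iff_norm.2 hξ1
  have hxξ : x₀ + r • ξ = x := by
    rw [hξ, smul_smul, mul_inv_cancel₀ hr0.ne', one_smul, add_sub_cancel]
  have hu : ‖x - x₀‖⁻¹ • (x - x₀) = ξ := by rw [hxn]
  have hξ0 : ξ ≠ 0 := fun h => by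
    rw [h, norm_zero] at hξ1
    exact zero_ne_one hξ1
  have hne : ∀ ρ : ℝ, 0 < ρ → x₀ + ρ • ξ ≠ x₀ := fun ρ hρ => center_add_smul_ne hρ hξS
  -- slices of functions smooth on `W₀` are differentiable at positive points
  have hslice : ∀ {f : ℝ × E3 → ℝ}, ContDiffOn ℝ (⊤ : ℕ∞) f W₀ → ∀ ρ : ℝ, 0 < ρ →
      HasDerivAt (fun s => f (s, ξ)) (deriv (fun s => f (s, ξ)) ρ) ρ := by
    intro f hf ρ hρ
    have hq : ((ρ, ξ) : ℝ × E3) ∈ W₀ := ⟨hρ, hξ0⟩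
    have hfd : DifferentiableAt ℝ f (ρ, ξ) :=
      (hf.differentiableOn (by simp) _ hq).differentiableAt (hW₀o.mem_nhds hq)
    have e : (fun s : ℝ => f (s, ξ)) = f ∘ fun s : ℝ => (s, ξ) := rfl
    have h1 : DifferentiableAt ℝ (fun s : ℝ => f (s, ξ)) ρ := by
      rw [e]
      exact hfd.comp ρ (differentiableAt_id.prodMk (differentiableAt_const ξ))
    exact h1.hasDerivAt
  -- the slice `g(ρ) = ρ · T(t, x₀ + ρ ξ)` through the maximiser and its derivatives
  set g : ℝ → ℝ := fun s => G (s, ξ) with hg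
  have hd_g : ∀ ρ : ℝ, 0 < ρ → HasDerivAt g (G₁ (ρ, ξ)) ρ := fun ρ hρ => hslice hGs ρ hρ
  have hd_g₂ : ∀ ρ : ℝ, 0 < ρ → HasDerivAt (fun s => G₂ (s, ξ)) (G₃ (ρ, ξ)) ρ := fun ρ hρ => hslice hG₂s ρ hρ
  have hderiv_g : ∀ ρ : ℝ, 0 < ρ → deriv g ρ = G₁ (ρ, ξ) := fun ρ hρ => (hd_g ρ hρ).deriv
  have hiter2 : iteratedDeriv 2 g = fun ρ => G₂ (ρ, ξ) := by
    rw [show (2 : ℕ) = 1 + 1 from rfl, iteratedDeriv_succ, iteratedDeriv_one]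
  -- `g` is `C²` on compact intervals inside `]0,∞[`
  have hgI : ∀ {u v : ℝ}, 0 < min u v → ContDiffOn ℝ 2 g (uIcc u v) := by
    intro u v huv
    have hsub : MapsTo (fun s : ℝ => ((s, ξ) : ℝ × E3)) (uIcc u v) W₀ := fun s hs =>
      ⟨huv.trans_le hs.1, hξ0⟩
    have h := hGs.comp (contDiffOn_id.prodMk contDiffOn_const) hsub
    exact h.of_le (WithTop.coe_le_coe.2 le_top)
  -- Taylor–Lagrange to second order at `r`
  have htaylor : ∀ {y : ℝ}, y ≠ r → 0 < min r y →
      ∃ θ ∈ uIoo r y, g y - (g r + (y - r) * deriv g r) = G₂ (θ, ξ) * (y - r) ^ 2 / 2 := by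
    intro y hy hmin
    have h2 : ContDiffOn ℝ 2 g (uIcc r y) := hgI hmin
    obtain ⟨θ, hθ, e⟩ := taylor_mean_remainder_lagrange_iteratedDeriv (n := 1) (Ne.symm hy) (h2.of_le (by norm_num))
    refine ⟨θ, hθ, ?_⟩
    have hud : UniqueDiffWithinAt ℝ (uIcc r y) r :=
      uniqueDiffOn_Icc (min_lt_max.2 (Ne.symm hy)) r ⟨min_le_left _ _, le_max_left _ _⟩
    have hdw : derivWithin g (uIcc r y) r = deriv g r := (hd_g r hr0).differentiableAt.derivWithin hud
    rw [taylorWithinEval_succ, taylor_within_zero_eval] at e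
    norm_num [Nat.factorial] at e
    rw [hdw] at e
    simpa only [hiter2] using e
  obtain ⟨θ₁, hθ₁, e₁⟩ := htaylor (y := r + k) (by linarith) (by rw [min_eq_left (by linarith)]; exact hr0)
  obtain ⟨θ₂, hθ₂, e₂⟩ := htaylor (y := r - k) (by linarith) (by rw [min_eq_right (by linarith)]; exact hrkpos)
  rw [uIoo_of_le (by linarith)] at hθ₁
  rw [uIoo_of_ge (by linarith)] at hθ₂
  have hθ₁I : θ₁ ∈ Icc c d := ⟨by linarith [hθ₁.1], by linarith [hθ₁.2]⟩
  have hθ₂I : θ₂ ∈ Icc c d := ⟨by linarith [hθ₂.1], by linarith [hθ₂.2]⟩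
  -- `G₂(·, ξ)` is `M`-Lipschitz on `[c,d]`
  have hlip : ∀ θ ∈ Icc c d, |G₂ (θ, ξ) - G₂ (r, ξ)| ≤ M * |θ - r| := by
    intro θ hθ
    have h := (convex_Icc c d).norm_image_sub_le_of_norm_hasDerivWithin_le
      (f := fun s => G₂ (s, ξ)) (f' := fun s => G₃ (s, ξ))
      (fun s hs => (hd_g₂ s (hc0.trans_le hs.1)).hasDerivWithinAt)
      (fun s hs => by rw [Real.norm_eq_abs]; exact hb₃ s hs ξ hξS) hrI hθ
    simpa only [Real.norm_eq_abs] using h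
  have hl₁ := hlip θ₁ hθ₁I
  have hl₂ := hlip θ₂ hθ₂I
  have ha₁ : |θ₁ - r| ≤ k := by rw [abs_le]; constructor <;> linarith [hθ₁.1, hθ₁.2]
  have ha₂ : |θ₂ - r| ≤ k := by rw [abs_le]; constructor <;> linarith [hθ₂.1, hθ₂.2]
  have hm₁ : M * |θ₁ - r| ≤ M * k := mul_le_mul_of_nonneg_left ha₁ hM0
  have hm₂ : M * |θ₂ - r| ≤ M * k := mul_le_mul_of_nonneg_left ha₂ hM0
  rw [abs_le] at hl₁ hl₂
  -- the second difference of the slice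
  have hsum : g (r + k) - 2 * g r + g (r - k) = (G₂ (θ₁, ξ) + G₂ (θ₂, ξ)) * k ^ 2 / 2 := by
    have e₁' : g (r + k) = g r + k * deriv g r + G₂ (θ₁, ξ) * k ^ 2 / 2 := by
      have := e₁; simp only [add_sub_cancel_left] at this; linarith
    have e₂' : g (r - k) = g r - k * deriv g r + G₂ (θ₂, ξ) * k ^ 2 / 2 := by
      have := e₂; simp only [sub_sub_cancel_left, neg_mul, even_two.neg_pow] at this; linarith
    rw [e₁', e₂']; ring
  have hkey : G₂ (r, ξ) ≤ (g (r + k) - 2 * g r + g (r - k)) / k ^ 2 + M * k := by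
    have hk2 : (0 : ℝ) < k ^ 2 := by positivity
    have e : (g (r + k) - 2 * g r + g (r - k)) / k ^ 2 = (G₂ (θ₁, ξ) + G₂ (θ₂, ξ)) / 2 := by
      rw [hsum]; field_simp
    rw [e]
    linarith
  -- `G₂(r, ξ) = 2 ∂_ξT(x) + r ∂_ξ²T(x) = 2·radDeriv + r·radDeriv2` at the maximiser
  set h : ℝ → ℝ := fun ρ => T t (x₀ + ρ • ξ) with hh
  set h₁ : ℝ → ℝ := fun ρ => fderiv ℝ (T t) (x₀ + ρ • ξ) ξ with hh₁
  set h₂ : ℝ → ℝ := fun ρ => fderiv ℝ (fderiv ℝ (T t)) (x₀ + ρ • ξ) ξ ξ with hh₂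
  have hd0 : ∀ ρ : ℝ, 0 < ρ → HasDerivAt h (h₁ ρ) ρ := fun ρ hρ => hasDerivAt_radial (hTd _ (hne ρ hρ))
  have hd1 : ∀ ρ : ℝ, 0 < ρ → HasDerivAt h₁ (h₂ ρ) ρ := by
    intro ρ hρ
    have hF : DifferentiableAt ℝ (fun y => fderiv ℝ (T t) y ξ) (x₀ + ρ • ξ) :=
      (hT2d _ (hne ρ hρ)).clm_apply (differentiableAt_const ξ)
    have h' := hasDerivAt_radial (x₀ := x₀) (ξ := ξ) hF
    have e : fderiv ℝ (fun y => fderiv ℝ (T t) y ξ) (x₀ + ρ • ξ) ξ = h₂ ρ := by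
      rw [fderiv_clm_apply (hT2d _ (hne ρ hρ)) (differentiableAt_const ξ)]
      simp [hh₂]
    rw [e] at h'
    exact h'
  have hG₁eq : ∀ ρ : ℝ, 0 < ρ → G₁ (ρ, ξ) = h ρ + ρ * h₁ ρ := by
    intro ρ hρ
    have h1 : HasDerivAt g (1 * h ρ + ρ * h₁ ρ) ρ := (hasDerivAt_id ρ).mul (hd0 ρ hρ)
    rw [← hderiv_g ρ hρ, h1.deriv, one_mul]
  have hG₂eq : G₂ (r, ξ) = 2 * h₁ r + r * h₂ r := by
    have hev : (fun s => G₁ (s, ξ)) =ᶠ[𝓝 r] fun s => h s + s * h₁ s := by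
      filter_upwards [Ioi_mem_nhds hr0] with s hs using hG₁eq s hs
    have h2 : HasDerivAt (fun s => h s + s * h₁ s) (h₁ r + (1 * h₁ r + r * h₂ r)) r :=
      (hd0 r hr0).add ((hasDerivAt_id r).mul (hd1 r hr0))
    show deriv (fun s => G₁ (s, ξ)) r = _
    rw [hev.deriv_eq, h2.deriv]
    ring
  have hrad1 : radDeriv (T t) x₀ x = h₁ r := by
    rw [radDeriv_eq_fderiv hxne (hTd x hxne), hu]
    show fderiv ℝ (T t) x ξ = fderiv ℝ (T t) (x₀ + r • ξ) ξ
    rw [hxξ]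
  have hrad2 : radDeriv2 (T t) x₀ x = h₂ r := by
    rw [radDeriv2_eq_fderiv_fderiv hxne hTt, hu]
    show fderiv ℝ (fderiv ℝ (T t)) x ξ ξ = fderiv ℝ (fderiv ℝ (T t)) (x₀ + r • ξ) ξ ξ
    rw [hxξ]
  have hA : r * radDeriv2 (T t) x₀ x + 2 * radDeriv (T t) x₀ x = G₂ (r, ξ) := by
    rw [hrad1, hrad2, hG₂eq]; ring
  -- the slice lies below the envelope and touches it at `ρ = r`
  have hgval : ∀ ρ : ℝ, g ρ = ρ * T t (x₀ + ρ • ξ) := fun ρ => rfl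
  have hleP : g (r + k) ≤ (r + k) * sphSup (T t) x₀ (r + k) := by
    rw [hgval]
    exact rsphSup_ge_slice (by linarith) (continuousOn_sphere_of_continuousOn_compl hTc (by linarith)) hξS
  have hleM : g (r - k) ≤ (r - k) * sphSup (T t) x₀ (r - k) := by
    rw [hgval]
    exact rsphSup_ge_slice hrkpos (continuousOn_sphere_of_continuousOn_compl hTc hrkpos) hξS
  have heq : g r = r * sphSup (T t) x₀ r := by
    rw [hgval, hxξ]
    have hx' : x₀ + r • ξ ∈ sphArgmax (T t) x₀ r := by rwa [hxξ]
    rw [rsphSup_eq_slice_of_mem_sphArgmax (continuousOn_sphere_of_continuousOn_compl hTc hr0) hx', hxξ]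
  have hΔ : g (r + k) - 2 * g r + g (r - k)
      ≤ (r + k) * sphSup (T t) x₀ (r + k) - 2 * (r * sphSup (T t) x₀ r) + (r - k) * sphSup (T t) x₀ (r - k) := by
    rw [heq]; linarith
  have hΔ' : (g (r + k) - 2 * g r + g (r - k)) / k ^ 2
      ≤ ((r + k) * sphSup (T t) x₀ (r + k) - 2 * (r * sphSup (T t) x₀ r) + (r - k) * sphSup (T t) x₀ (r - k)) / k ^ 2 :=
    div_le_div_of_nonneg_right hΔ (sq_nonneg k)
  rw [hA]
  linarith

/-- **Second-difference touching bound (inf envelope)**: the mirror statement at minimisers,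
`Δ²_k[ρ ↦ ρ · min_{S_ρ(x₀)} T(t)](r)/k² − M k ≤ r ∂_r²T(t,x) + 2 ∂_rT(t,x)` for `x ∈ argmin_{S_r(x₀)} T(t)` (the sup statement for
`−T`). [folklore] -/
theorem exists_secondDiff_touching_inf (hT : ContDiffOn ℝ (⊤ : ℕ∞) (uncurry T) (Ioo t₀ 0 ×ˢ ({x₀}ᶜ : Set E3)))
    {t : ℝ} (ht : t ∈ Ioo t₀ 0) {a R : ℝ} (ha : 0 < a) :
    ∃ M k₀ : ℝ, 0 < k₀ ∧ k₀ < a ∧ ∀ k ∈ Ioo 0 k₀, ∀ r ∈ Icc a R, ∀ x ∈ sphArgmin (T t) x₀ r,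
      ((r + k) * sphInf (T t) x₀ (r + k) - 2 * (r * sphInf (T t) x₀ r)
          + (r - k) * sphInf (T t) x₀ (r - k)) / k ^ 2 - M * k
        ≤ r * radDeriv2 (T t) x₀ x + 2 * radDeriv (T t) x₀ x := by
  obtain ⟨M, k₀, hk₀, hk₀a, h⟩ :=
    exists_secondDiff_touching_sup (T := fun s y => -T s y) (contDiffOn_neg_family hT) ht ha
  refine ⟨M, k₀, hk₀, hk₀a, fun k hk r hr x hx => ?_⟩
  rw [sphArgmin_eq_sphArgmax_neg] at hx
  have h1 := h k hk r hr x hx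
  simp only [radDeriv_neg, radDeriv2_neg, sphSup_neg_eq] at h1
  have e : ((r + k) * -sphInf (T t) x₀ (r + k) - 2 * (r * -sphInf (T t) x₀ r) + (r - k) * -sphInf (T t) x₀ (r - k)) / k ^ 2
      = -(((r + k) * sphInf (T t) x₀ (r + k) - 2 * (r * sphInf (T t) x₀ r)
          + (r - k) * sphInf (T t) x₀ (r - k)) / k ^ 2) := by
    ring
  rw [e] at h1
  linarith

/-- **Second-difference touching bound, both envelopes, common constants** (part (c) of `EnvelopeFacts`). [folklore] -/
theorem exists_secondDiff_touching (hT : ContDiffOn ℝ (⊤ : ℕ∞) (uncurry T) (Ioo t₀ 0 ×ˢ ({x₀}ᶜ : Set E3)))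
    {t : ℝ} (ht : t ∈ Ioo t₀ 0) {a R : ℝ} (ha : 0 < a) :
    ∃ M k₀ : ℝ, 0 < k₀ ∧ k₀ < a ∧
      ∀ k ∈ Ioo 0 k₀, ∀ r ∈ Icc a R,
        (∀ x ∈ sphArgmax (T t) x₀ r,
            r * radDeriv2 (T t) x₀ x + 2 * radDeriv (T t) x₀ x
              ≤ ((r + k) * sphSup (T t) x₀ (r + k) - 2 * (r * sphSup (T t) x₀ r)
                  + (r - k) * sphSup (T t) x₀ (r - k)) / k ^ 2 + M * k) ∧
        (∀ x ∈ sphArgmin (T t) x₀ r,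
            ((r + k) * sphInf (T t) x₀ (r + k) - 2 * (r * sphInf (T t) x₀ r)
                + (r - k) * sphInf (T t) x₀ (r - k)) / k ^ 2 - M * k
              ≤ r * radDeriv2 (T t) x₀ x + 2 * radDeriv (T t) x₀ x) := by
  obtain ⟨M₁, k₁, hk₁, hk₁a, h₁⟩ := exists_secondDiff_touching_sup hT ht ha
  obtain ⟨M₂, k₂, hk₂, _, h₂⟩ := exists_secondDiff_touching_inf hT ht ha
  refine ⟨max M₁ M₂, min k₁ k₂, lt_min hk₁ hk₂, (min_le_left _ _).trans_lt hk₁a, fun k hk r hr => ⟨?_, ?_⟩⟩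
  · intro x hx
    have h := h₁ k ⟨hk.1, lt_of_lt_of_le hk.2 (min_le_left _ _)⟩ r hr x hx
    have hm : M₁ * k ≤ max M₁ M₂ * k := mul_le_mul_of_nonneg_right (le_max_left _ _) hk.1.le
    linarith
  · intro x hx
    have h := h₂ k ⟨hk.1, lt_of_lt_of_le hk.2 (min_le_right _ _)⟩ r hr x hx
    have hm : M₂ * k ≤ max M₁ M₂ * k := mul_le_mul_of_nonneg_right (le_max_right _ _) hk.1.le
    linarith

/-! ### Assembly: `NetFlux.EnvelopeFacts` -/

/-- **`NetFlux.EnvelopeFacts` (LINE v5 «netflux-typei-gap», NF-1bᵛ), proved** — verbatim body of the line's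
`def EnvelopeFacts : Prop` (Lines file `Cruxes/PoloidalLiouville/Lines/netflux_typei_gap.lean`, §1): for `T` smooth on
`]t₀,0[ × (ℝ³ ∖ {x₀})`: (a) `(t,r) ↦ max_{S_r(x₀)} T(t)` and `min_{S_r(x₀)} T(t)` are continuous on `]t₀,0[ × ]0,∞[`; (b) the
functions `r ↦ r·max` / `r ↦ r·min` have one-sided `r`-derivatives at every `r > 0`, ordered `∂⁻ ≤ ∂⁺` / `∂⁺ ≤ ∂⁻`; (c) the uniform
second-difference touching bounds at maximisers / minimisers.  The line's `stub_envelopeFacts : EnvelopeFacts` is closed by this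
theorem (definitional unfolding).  No NS statement is involved. [folklore] -/
theorem envelopeFacts :
    ∀ (T : ℝ → E3 → ℝ) (x₀ : E3) (t₀ : ℝ),
      ContDiffOn ℝ (⊤ : ℕ∞) (uncurry T) (Ioo t₀ 0 ×ˢ ({x₀}ᶜ : Set E3)) →
        ContinuousOn (fun p : ℝ × ℝ => sphSup (T p.1) x₀ p.2) (Ioo t₀ 0 ×ˢ Ioi 0) ∧
        ContinuousOn (fun p : ℝ × ℝ => sphInf (T p.1) x₀ p.2) (Ioo t₀ 0 ×ˢ Ioi 0) ∧
        (∀ t ∈ Ioo t₀ 0, ∀ r > 0, ∃ dp dm : ℝ,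
            HasDerivWithinAt (fun ρ => ρ * sphSup (T t) x₀ ρ) dp (Ioi r) r ∧
            HasDerivWithinAt (fun ρ => ρ * sphSup (T t) x₀ ρ) dm (Iio r) r ∧ dm ≤ dp) ∧
        (∀ t ∈ Ioo t₀ 0, ∀ r > 0, ∃ dp dm : ℝ,
            HasDerivWithinAt (fun ρ => ρ * sphInf (T t) x₀ ρ) dp (Ioi r) r ∧
            HasDerivWithinAt (fun ρ => ρ * sphInf (T t) x₀ ρ) dm (Iio r) r ∧ dp ≤ dm) ∧
        (∀ t ∈ Ioo t₀ 0, ∀ a R : ℝ, 0 < a → a ≤ R → ∃ M k₀ : ℝ, 0 < k₀ ∧ k₀ < a ∧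
            ∀ k ∈ Ioo 0 k₀, ∀ r ∈ Icc a R,
              (∀ x ∈ sphArgmax (T t) x₀ r,
                  r * radDeriv2 (T t) x₀ x + 2 * radDeriv (T t) x₀ x
                    ≤ ((r + k) * sphSup (T t) x₀ (r + k) - 2 * (r * sphSup (T t) x₀ r)
                        + (r - k) * sphSup (T t) x₀ (r - k)) / k ^ 2 + M * k) ∧
              (∀ x ∈ sphArgmin (T t) x₀ r,
                  ((r + k) * sphInf (T t) x₀ (r + k) - 2 * (r * sphInf (T t) x₀ r)
                      + (r - k) * sphInf (T t) x₀ (r - k)) / k ^ 2 - M * k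
                    ≤ r * radDeriv2 (T t) x₀ x + 2 * radDeriv (T t) x₀ x)) := by
  intro T x₀ t₀ hT
  refine ⟨continuousOn_sphSup_family hT.continuousOn, continuousOn_sphInf_family hT.continuousOn,
    fun t ht r hr => exists_oneSided_deriv_rsphSup hT ht hr,
    fun t ht r hr => exists_oneSided_deriv_rsphInf hT ht hr,
    fun t ht a R ha _ => exists_secondDiff_touching (R := R) hT ht ha⟩

end Summit.NavierStokesRegularity.NavierStokesRegularity.Theorems.PoloidalLiouville.NetFlux

end
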